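import Summits.QuantumFields.YangMills.Theorems.SqueezedSkewnessCollarBumpFloors
import Summits.QuantumFields.YangMills.Theorems.SqueezedSkewnessFemtoCurrencyGlue
import Summits.QuantumFields.YangMills.Theorems.SqueezedSkewnessChordEscalator
import Summits.QuantumFields.YangMills.Theorems.SqueezedSkewnessFemtoCeiling
import Summits.QuantumFields.YangMills.Theorems.SqueezedSkewnessSeamFromMomentsProof
import Summits.QuantumFields.YangMills.Theorems.SqueezedSkewnessHypercubeSeam
import Summits.QuantumFields.YangMills.Theorems.SqueezedSkewnessShellGeometry
import HarnessLib

/-!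
# Route `SqueezedSkewness`, LINE χ₃ «self-sufficient unit»: the kernel-checked χ-chain to `BalabanLadder.NT` (stmt-QuantumFields-19353)

Fleet lead `ym-spine-19353-p1` g20.  With `CollarBumpFloors` (23680, this seat), `FemtoCurrencyGlue` (23681), `ChordEscalator` (23546),
`FemtoCeiling` (23547), `SeamFromMoments` (23395), `HypercubeSeam` (27937) and `ShellGeometry` (27860) all PROVED in the tree, the rung
`BalabanLadder.NT` of route `SqueezedSkewness` (deciding theorem `closes`, rev 22) reduces BY NAME to exactly three open items:

* `FemtoTwoPointUnit` (23679, XL — the spine's femto two-point package `FBL6 ∧ FC2` at one unit),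
* `TorusKL` (23204, L− — the finite-period Källén–Lehmann identity on the torus),
* `ShellSign` (27861 — the clause-(ii) sign).

This file records the two compositions:
* `pointlikeHypercubeFloorsB_of_femto : FemtoFloorUnit → TorusKL → PointlikeHypercubeFloorsB` — the node-B composition of LINE χ
  (planner ym-idea-6 g12's `PointlikeChordBirth3.PointlikeHypercubeFloorsB_of`, restated against the route decls with the landed
  `ChordEscalator` / `FemtoCeiling` plugged in: the femto unit carries `FBL6` already, the chord escalator turns the femto-window floor
  and the femto ceiling into the unit-height floor `(min ε 1)^A / (max C 1)^A`);
* `nt_of_femtoTwoPointUnit_torusKL_shellSign : FemtoTwoPointUnit → TorusKL → ShellSign → BalabanLadder.NT`.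

HONEST FRAMING: pure composition of landed theorems; the three hypotheses are OPEN (23679 is engine-grade / Bałaban-class); no NT
statement, rung of record or mass gap is proved here; not Clay. [folklore]
-/

set_option autoImplicit false

namespace Summit.QuantumFields.YangMills.Theorems.SqueezedSkewnessChiChain

open Summit.QuantumFields.YangMills.Theses.SqueezedSkewness

/-- **Node B of LINE χ**: `FemtoFloorUnit → TorusKL → PointlikeHypercubeFloorsB` (the unit of `FemtoFloorUnit` keeps its `FBL6`; the
every-radius unit-height floors come from the chord escalator (`ChordEscalator` ✓, from `TorusKL`) fed with the femto-window floor
and the femto ceiling (`FemtoCeiling` ✓, from `FBL6`) — the composition of `SqueezedSkewnessChordFloorsGlue` with one more conjunct).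
[folklore] -/
theorem pointlikeHypercubeFloorsB_of_femto (h1 : FemtoFloorUnit) (h3 : TorusKL) : PointlikeHypercubeFloorsB := by
  have h4 : ChordEscalator := Summit.QuantumFields.YangMills.Theorems.ChordEscalatorProof.chordEscalator_proof
  have h5 : FemtoCeiling := Summit.QuantumFields.YangMills.Theorems.FemtoCeilingProof.femtoCeiling_proof
  intro G i1 i2 i3 i4 hG
  letI : MeasurableSpace G := borel G
  haveI : BorelSpace G := ⟨rfl⟩
  obtain ⟨r, a, h1'⟩ := h1 G hG
  refine ⟨r, a, ?_⟩
  dsimp only at h1' ⊢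
  obtain ⟨ha, ha0, hF6, hall⟩ := h1'
  refine ⟨ha, ha0, hF6, fun ρ hρ => ?_⟩
  obtain ⟨v, hv0, hball, δ₁, δ₂, h₁, ε, β₅, Λ₅, hδ₁, hslab, hh₁, h3h₁, hε, hfloor⟩ := hall ρ hρ
  -- the femto ceiling of the unit (from `FBL6`)
  have h5' := h5 G hG r a ha ha0 hF6
  dsimp only at h5'
  obtain ⟨C, β₆, Λ₆, hceil⟩ := h5' v ρ δ₁ δ₂ h₁ hh₁ hball hslab
  -- the chord escalator of the hypercube (from `TorusKL`)
  have h4' := h4 h3 G hG r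
  dsimp only at h4'
  -- thresholds: `a β < min h₁ 1` eventually
  obtain ⟨β₇, hβ₇⟩ : ∃ β₇ : ℝ, ∀ β, β₇ ≤ β → a β < min h₁ 1 := by
    have h1 : ∀ᶠ β in Filter.atTop, a β < min h₁ 1 :=
      ha0.eventually (gt_mem_nhds (lt_min hh₁ one_pos))
    exact Filter.eventually_atTop.mp h1
  refine ⟨v, hv0, hball, δ₁, δ₂, (min ε 1) ^ ⌈2 * δ₁ / h₁⌉₊ / (max C 1) ^ ⌈2 * δ₁ / h₁⌉₊,
    max β₅ (max β₆ (max β₇ 0)), max Λ₅ (max Λ₆ (ρ + |δ₂| + 1)), hδ₁, hslab, by positivity, ?_⟩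
  intro β hβ L hL
  simp only [max_le_iff] at hβ hL
  obtain ⟨hβ5, hβ6, hβ7, hβ0⟩ := hβ
  obtain ⟨hΛ5, hΛ6, hΛρ⟩ := hL
  have hs : 0 < a β := ha β
  have hsh : a β ≤ h₁ := (hβ₇ β hβ7).le.trans (min_le_left _ _)
  have hs1 : a β ≤ 1 := (hβ₇ β hβ7).le.trans (min_le_right _ _)
  have hL1 : 1 ≤ L := by
    have h1 : (1 : ℝ) ≤ a β * L := by linarith [abs_nonneg δ₂, hρ.le]
    have h2 : (1 : ℝ) ≤ (L : ℝ) := h1.trans (mul_le_of_le_one_left (Nat.cast_nonneg L) hs1)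
    exact_mod_cast h2
  have hwin : ρ + δ₂ + 1 ≤ a β * L := by linarith [le_abs_self δ₂]
  exact h4' β L (a β) v ρ δ₁ δ₂ h₁ h₁ (min ε 1) (max C 1) hβ0 hL1 hs hsh le_rfl h3h₁ hs1 hwin hball hslab
    (lt_min hε one_pos) (min_le_right _ _) (le_max_right _ _)
    (fun k f hk1 hk2 hf => (min_le_left _ _).trans (hfloor β hβ5 L hΛ5 (a β * k) f hk1 hk2 hf))
    (fun k g hk hg => (hceil β hβ6 L hΛ6 k g hk hg).trans (le_max_left _ _))

/-- **The χ-chain to the rung leaf**: `FemtoTwoPointUnit → TorusKL → ShellSign → BalabanLadder.NT` — the femto currency glue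
(`FemtoCurrencyGlue` ✓ with `CollarBumpFloors` ✓) gives `FemtoFloorUnit`, node B above gives `PointlikeHypercubeFloorsB`, and the route's
deciding theorem `closes` with the PROVED `SeamFromMoments`, `HypercubeSeam`, `ShellGeometry` concludes `NT` by name.  The three
hypotheses are exactly the open items 23679, 23204, 27861 of route `SqueezedSkewness` (rev 22) on the χ path. [folklore] -/
theorem nt_of_femtoTwoPointUnit_torusKL_shellSign (hU : FemtoTwoPointUnit) (hKL : TorusKL) (hSign : ShellSign) :
    Summit.QuantumFields.YangMills.Theses.BalabanLadder.NT :=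
  closes
    (pointlikeHypercubeFloorsB_of_femto
      (Summit.QuantumFields.YangMills.Theorems.squeezedSkewness_femtoCurrencyGlue_proof hU
        Summit.QuantumFields.YangMills.Theorems.CollarBumpFloorsProof.collarBumpFloors_proof) hKL)
    Summit.QuantumFields.YangMills.Theorems.squeezedSkewness_seamFromMoments_proof
    Summit.QuantumFields.YangMills.Theorems.squeezedSkewness_hypercubeSeam
    Summit.QuantumFields.YangMills.Theorems.squeezedSkewness_shellGeometry hSign

end Summit.QuantumFields.YangMills.Theorems.SqueezedSkewnessChiChain
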